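import Summits.KontsevichZagierPeriods.KontsevichZagierPeriods.Theses.TerasomaMultiplication
import Literature.NumberTheory.Transcendental.KZRulesAssociator
import Literature.NumberTheory.Transcendental.KZKernelConjectureForms
import Literature.NumberTheory.Transcendental.KZCalculusProofs
import Literature.NumberTheory.Transcendental.GammaMonomials

/-!
# Crux-ideate sketch — `CompleteModGammaSector` (stmt-KontsevichZagierPeriods-14233), round 1, ideator 2

Scratch file of planner-cruxidea-stmt-KontsevichZagierPeriods-14233-2-0. Every `theorem` below is
sorry-free; the `def … : Prop` items are the typed FIRST LEMMAS of the three idea cards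

* §0  vocabulary: the Γ-pair set VERBATIM, `CompleteMod S` (Conjecture 1 relative to an axiom set
      `S`), `crux_iff_completeMod : CompleteModGammaSector ↔ CompleteMod gammaPairSet` (proved),
      kernel form `completeMod_iff_kernel` (proved);
* §A  card `domain-mod-gamma`: the Γ-ideal `JGamma` of the formal period ring
      `KZ.FormalPeriodRing = FormalRep ⧸ relations`, `IdealKernelModGamma ↔ IsPrimeModGamma ∧
      WeakKernelModGamma` (proved), `idealKernel_of_crux` (proved), `crux_iff_idealKernel_and_seam`
      (proved), cancellation and ROOT EXTRACTION from primality (proved);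
* §B  card `divisor-classifies-families`: Γ-families with affine arguments, the pole divisor,
      `DivisorLemma` (first lemma, combinatorial), `FunctionalImpliesBalanced` (analytic bridge),
      `BetaFamiliesModGamma` (the sector of the crux it closes);
* §C  card `complement-lattice-merge`: the Galois-connection laws of `CompleteMod` (proved) and
      `crux_of_merge` (proved), `summit_iff_completeMod_empty` (proved).
-/

noncomputable section

set_option linter.dupNamespace false

open MeasureTheory Set
open scoped BigOperators

namespace Summit.KontsevichZagierPeriods.KontsevichZagierPeriods.Cruxes.CompleteModGammaSector.IdeatorTwo

open Literature.NumberTheory.Transcendental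
open Literature.NumberTheory.Transcendental.KZ
open Summit.KontsevichZagierPeriods.KontsevichZagierPeriods.Theses.TerasomaMultiplication
  (CompleteModGammaSector GammaHodgeSector)

/-! ## §0 Vocabulary: Γ-pairs, relative completeness, kernel form -/

/-- The generating set of the Γ-sector: VERBATIM the set quantified inside `CompleteModGammaSector`
(cube Beta representation minus `c·k!`·(2k-ball × cube) representation under the
Deligne–Koblitz–Ogus hypotheses). -/
def gammaPairSet : Set FormalRep :=
  {d | ∃ (N N' k : ℕ) (x y : Fin N → ℚ) (x' y' : Fin N' → ℚ) (c : ℝ)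
      (ρ : IntegralRep N) (ρ' : IntegralRep (2 * k + N')),
    (∀ j, 0 < x j ∧ 0 < y j ∧ Int.fract (x j) ≠ 0 ∧ Int.fract (y j) ≠ 0) ∧
    (∀ l, 0 < x' l ∧ 0 < y' l ∧ Int.fract (x' l) ≠ 0 ∧ Int.fract (y' l) ≠ 0) ∧
    (∀ u : ℕ, 0 < u → (∀ j, Nat.Coprime u (x j).den ∧ Nat.Coprime u (y j).den) →
      (∀ l, Nat.Coprime u (x' l).den ∧ Nat.Coprime u (y' l).den) →
      ((∑ j, (Int.fract ((u : ℚ) * x j) + Int.fract ((u : ℚ) * y j) -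
          Int.fract ((u : ℚ) * (x j + y j)))) -
        ∑ l, (Int.fract ((u : ℚ) * x' l) + Int.fract ((u : ℚ) * y' l) -
          Int.fract ((u : ℚ) * (x' l + y' l)))) = (k : ℚ)) ∧
    IsAlgebraic ℚ c ∧
    ρ.domain = {t | ∀ j, t j ∈ Set.Ioo (0:ℝ) 1} ∧
    Set.EqOn ρ.integrand (fun t => ∏ j, (t j) ^ ((x j : ℝ) - 1) * (1 - t j) ^ ((y j : ℝ) - 1))
      ρ.domain ∧
    ρ'.domain = {z | (∑ i : Fin (2 * k), (z (Fin.castAdd N' i)) ^ 2) < 1 ∧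
      ∀ l : Fin N', z (Fin.natAdd (2 * k) l) ∈ Set.Ioo (0:ℝ) 1} ∧
    Set.EqOn ρ'.integrand (fun z => c * (k.factorial : ℝ) *
      ∏ l, (z (Fin.natAdd (2 * k) l)) ^ ((x' l : ℝ) - 1) *
        (1 - z (Fin.natAdd (2 * k) l)) ^ ((y' l : ℝ) - 1)) ρ'.domain ∧
    ρ.value = ρ'.value ∧ d = of ρ - of ρ'}

/-- **Conjecture 1 relative to an axiom set `S`**: every difference of rational representations of
the same number lies in `relations ⊔ closure S`.  `S = ∅` is the summit, `S = gammaPairSet` is the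
crux, `S = ker eval` is trivially true (card C: the lattice of complements). -/
def CompleteMod (S : Set FormalRep) : Prop :=
  ∀ ⦃n m : ℕ⦄ (r : IntegralRep n) (r' : IntegralRep m), r.IsRational → r'.IsRational →
    r.value = r'.value → of r - of r' ∈ relations ⊔ AddSubgroup.closure S

/-- Kernel form relative to `S`. -/
def KernelMod (S : Set FormalRep) : Prop :=
  ∀ c : FormalRep, eval c = 0 → c ∈ relations ⊔ AddSubgroup.closure S

/-- **The crux is `CompleteMod gammaPairSet`** (the `∀ H` of the crux collapses on the least
admissible `H`). -/
theorem crux_iff_completeMod : CompleteModGammaSector ↔ CompleteMod gammaPairSet := by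
  constructor
  · intro h n m r r' hr hr' hv
    refine h (relations ⊔ AddSubgroup.closure gammaPairSet) le_sup_left ?_ r r' hr hr' hv
    intro N N' k x y x' y' c hx hx' hu hc ρ ρ' hd hi hd' hi' hval
    exact AddSubgroup.mem_sup_right (AddSubgroup.subset_closure
      ⟨N, N', k, x, y, x', y', c, ρ, ρ', hx, hx', hu, hc, hd, hi, hd', hi', hval, rfl⟩)
  · intro h H hH hpairs n m r r' hr hr' hv
    have hle : relations ⊔ AddSubgroup.closure gammaPairSet ≤ H := by
      refine sup_le hH ((AddSubgroup.closure_le _).mpr ?_)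
      rintro d ⟨N, N', k, x, y, x', y', c, ρ, ρ', hx, hx', hu, hc, hd, hi, hd', hi', hval, rfl⟩
      exact hpairs N N' k x y x' y' c hx hx' hu hc ρ ρ' hd hi hd' hi' hval
    exact hle (h r r' hr hr' hv)

/-- **Two-representation form ↔ kernel form**, relative to any `S` (bookkeeping facts
`KZ.exists_integralRep_sub_holds`, `KZ.exists_isRational_equivalent_holds`, soundness). -/
theorem completeMod_iff_kernel (S : Set FormalRep) : CompleteMod S ↔ KernelMod S := by
  constructor
  · intro h c hc
    obtain ⟨n, m, r, r', hrel⟩ := exists_integralRep_sub_holds c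
    obtain ⟨N, R, hR, hrR⟩ := exists_isRational_equivalent_holds r
    obtain ⟨N', R', hR', hrR'⟩ := exists_isRational_equivalent_holds r'
    have hker : eval (c - (of r - of r')) = 0 := relations_le_ker_eval_holds hrel
    rw [map_sub, hc, zero_sub, neg_eq_zero, eval_of_sub_of, sub_eq_zero] at hker
    have hvR : R.value = R'.value := by
      rw [← Equivalent.value_eq_holds hrR, ← Equivalent.value_eq_holds hrR', hker]
    have h1 : of R - of R' ∈ relations ⊔ AddSubgroup.closure S := h R R' hR hR' hvR
    have h2 : of r - of R ∈ relations ⊔ AddSubgroup.closure S := AddSubgroup.mem_sup_left hrR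
    have h3 : of r' - of R' ∈ relations ⊔ AddSubgroup.closure S := AddSubgroup.mem_sup_left hrR'
    have h4 : c - (of r - of r') ∈ relations ⊔ AddSubgroup.closure S :=
      AddSubgroup.mem_sup_left hrel
    have : c = (c - (of r - of r')) + (of r - of R) + (of R - of R') - (of r' - of R') := by abel
    rw [this]
    exact sub_mem (add_mem (add_mem h4 h2) h1) h3
  · intro h n m r r' _ _ hv
    apply h
    rw [eval_of_sub_of, hv, sub_self]

/-- Every Γ-pair difference evaluates to `0` (its value conjunct). -/
theorem eval_eq_zero_of_mem_gammaPairSet : ∀ d ∈ gammaPairSet, eval d = 0 := by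
  rintro d ⟨N, N', k, x, y, x', y', c, ρ, ρ', -, -, -, -, -, -, -, -, hval, rfl⟩
  rw [eval_of_sub_of, hval, sub_self]

/-! ## §A  Card `domain-mod-gamma`: integrality of the formal period ring relative to Γ -/

/-- The **Γ-ideal** of the formal period ring `P = FormalRep ⧸ relations`: the ideal generated by
the classes of the Γ-pair differences (the IDEAL form; the crux as typed uses the subgroup, see
`SubgroupSeam`). -/
def JGamma : Ideal FormalPeriodRing := Ideal.span (toFormalPeriod '' gammaPairSet)

/-- Conjecture 1 modulo the Γ-IDEAL (kernel form). -/
def IdealKernelModGamma : Prop := ∀ p : FormalPeriodRing, evalP p = 0 → p ∈ JGamma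

/-- **Integrality relative to Γ** (value-free): the Γ-ideal is prime, i.e. `P ⧸ JΓ` is an
integral domain — no zero-divisors modulo the moves and the Deligne–Koblitz–Ogus identities. -/
def IsPrimeModGamma : Prop := JGamma.IsPrime

/-- **Conjecture 1 in the fraction field, relative to Γ**: a value-zero class dies modulo `JΓ`
after multiplication by SOME class of non-zero value (an amplifier of one's choice). -/
def WeakKernelModGamma : Prop :=
  ∀ p : FormalPeriodRing, evalP p = 0 → ∃ m : FormalPeriodRing, evalP m ≠ 0 ∧ m * p ∈ JGamma

theorem JGamma_le_ker : JGamma ≤ RingHom.ker evalP := by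
  refine Ideal.span_le.mpr ?_
  rintro p ⟨d, hd, rfl⟩
  rw [SetLike.mem_coe, RingHom.mem_ker, evalP_toFormalPeriod]
  exact eval_eq_zero_of_mem_gammaPairSet d hd

theorem JGamma_ne_top : JGamma ≠ ⊤ := by
  intro h
  have h1 : (1 : FormalPeriodRing) ∈ JGamma := by rw [h]; exact Submodule.mem_top
  have h2 := JGamma_le_ker h1
  rw [RingHom.mem_ker, map_one] at h2
  exact one_ne_zero h2

theorem evalP_ne_zero_not_mem {m : FormalPeriodRing} (hm : evalP m ≠ 0) : m ∉ JGamma :=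
  fun h => hm (JGamma_le_ker h)

/-- **THE SPLIT** (Ayoub's Cor. 32 / Huber–Wüstholz's effective-injectivity question, inside the
rules and relative to Γ): Conjecture 1 mod the Γ-ideal ⟺ (JΓ is prime) ∧ (fraction-field form). -/
theorem idealKernel_iff : IdealKernelModGamma ↔ IsPrimeModGamma ∧ WeakKernelModGamma := by
  constructor
  · intro h
    refine ⟨Ideal.isPrime_iff.mpr ⟨JGamma_ne_top, @fun a b hab => ?_⟩, fun p hp => ?_⟩
    · have h0 : evalP (a * b) = 0 := JGamma_le_ker hab
      rw [map_mul, mul_eq_zero] at h0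
      rcases h0 with ha | hb
      · exact Or.inl (h a ha)
      · exact Or.inr (h b hb)
    · exact ⟨1, by rw [map_one]; exact one_ne_zero, by rw [one_mul]; exact h p hp⟩
  · rintro ⟨hprime, hweak⟩ p hp
    obtain ⟨m, hm, hmp⟩ := hweak p hp
    rcases hprime.mem_or_mem hmp with hm' | hp'
    · exact absurd hm' (evalP_ne_zero_not_mem hm)
    · exact hp'

/-- The subgroup sector maps into the Γ-ideal. -/
theorem toFormalPeriod_mem_JGamma {c : FormalRep}
    (hc : c ∈ relations ⊔ AddSubgroup.closure gammaPairSet) : toFormalPeriod c ∈ JGamma := by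
  have hle : relations ⊔ AddSubgroup.closure gammaPairSet ≤
      (JGamma.toAddSubgroup).comap toFormalPeriod.toAddMonoidHom := by
    refine sup_le ?_ ((AddSubgroup.closure_le _).mpr ?_)
    · intro d hd
      rw [AddSubgroup.mem_comap]
      show toFormalPeriod d ∈ JGamma
      rw [toFormalPeriod_eq_zero_of_mem hd]
      exact JGamma.zero_mem
    · intro d hd
      rw [SetLike.mem_coe, AddSubgroup.mem_comap]
      show toFormalPeriod d ∈ JGamma
      exact Ideal.subset_span ⟨d, hd, rfl⟩
  have := hle hc
  rw [AddSubgroup.mem_comap] at this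
  exact this

/-- **The crux implies Conjecture 1 modulo the Γ-ideal** (hence, by `idealKernel_iff`, the crux
implies primality of `JΓ` — a value-free necessary condition — and the fraction-field form). -/
theorem idealKernel_of_crux (h : CompleteModGammaSector) : IdealKernelModGamma := by
  have hK : KernelMod gammaPairSet :=
    (completeMod_iff_kernel gammaPairSet).mp (crux_iff_completeMod.mp h)
  intro p hp
  obtain ⟨c, rfl⟩ := toFormalPeriod_surjective p
  rw [evalP_toFormalPeriod] at hp
  exact toFormalPeriod_mem_JGamma (hK c hp)

theorem isPrime_of_crux (h : CompleteModGammaSector) : IsPrimeModGamma :=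
  (idealKernel_iff.mp (idealKernel_of_crux h)).1

/-- **The typing seam** (card spectator-stability-split, restated on `P`): the subgroup sector is
the full preimage of the Γ-ideal. -/
def SubgroupSeam : Prop :=
  ∀ c : FormalRep, toFormalPeriod c ∈ JGamma → c ∈ relations ⊔ AddSubgroup.closure gammaPairSet

/-- crux ⟺ (Conjecture 1 mod the Γ-ideal) ∧ seam ⟺ prime ∧ fraction-field form ∧ seam. -/
theorem crux_iff_idealKernel_and_seam :
    CompleteModGammaSector ↔ IdealKernelModGamma ∧ SubgroupSeam := by
  constructor
  · intro h
    refine ⟨idealKernel_of_crux h, fun c hc => ?_⟩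
    have hK : KernelMod gammaPairSet :=
      (completeMod_iff_kernel gammaPairSet).mp (crux_iff_completeMod.mp h)
    exact hK c (by have := JGamma_le_ker hc; rwa [RingHom.mem_ker, evalP_toFormalPeriod] at this)
  · rintro ⟨h1, h2⟩
    refine crux_iff_completeMod.mpr ((completeMod_iff_kernel gammaPairSet).mpr fun c hc => ?_)
    exact h2 c (h1 _ (by rw [evalP_toFormalPeriod]; exact hc))

theorem crux_iff_prime_weak_seam :
    CompleteModGammaSector ↔ IsPrimeModGamma ∧ WeakKernelModGamma ∧ SubgroupSeam := by
  rw [crux_iff_idealKernel_and_seam, idealKernel_iff, and_assoc]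

/-- **Cancellation from primality**: any class of non-zero value is a non-zero-divisor mod `JΓ`
(so π-cancellation and Beta-cancellation mod Γ are corollaries, with no reflection/Dirichlet
chains). -/
theorem cancellation_of_isPrime (hP : IsPrimeModGamma) {m c : FormalPeriodRing}
    (hm : evalP m ≠ 0) (h : m * c ∈ JGamma) : c ∈ JGamma := by
  rcases hP.mem_or_mem h with h' | h'
  · exact absurd h' (evalP_ne_zero_not_mem hm)
  · exact h'

theorem piCancellationModGamma_of_isPrime (hP : IsPrimeModGamma) {c : FormalPeriodRing}
    (h : toFormalPeriod (of piRep) * c ∈ JGamma) : c ∈ JGamma :=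
  cancellation_of_isPrime hP (by rw [evalP_toFormalPeriod_of, piRep_value]; exact Real.pi_ne_zero) h

/-- **ROOT EXTRACTION mod Γ** (amplification): in the prime quotient a square-identity between
classes of non-cancelling values descends to the identity itself. -/
theorem rootExtraction_of_isPrime (hP : IsPrimeModGamma) {a b : FormalPeriodRing}
    (h2 : a * a - b * b ∈ JGamma) (hne : evalP (a + b) ≠ 0) : a - b ∈ JGamma := by
  have hmem : (a + b) * (a - b) ∈ JGamma := by
    have : (a + b) * (a - b) = a * a - b * b := by ring
    rw [this]; exact h2
  exact cancellation_of_isPrime hP hne hmem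

/-- `k`-th power version: `a^k ≡ b^k`, and the cyclotomic cofactor has non-zero value. -/
theorem rootExtraction_pow_of_isPrime (hP : IsPrimeModGamma) {a b q : FormalPeriodRing} {k : ℕ}
    (hfac : a ^ k - b ^ k = (a - b) * q) (hk : a ^ k - b ^ k ∈ JGamma) (hq : evalP q ≠ 0) :
    a - b ∈ JGamma := by
  have : q * (a - b) ∈ JGamma := by rw [mul_comm, ← hfac]; exact hk
  exact cancellation_of_isPrime hP hq this

/-! ## §B  Card `divisor-classifies-families`: Γ-families, pole divisors, Hodge balance -/

/-- A **Γ-family**: finitely many affine arguments `ℓ_i(s) = a_i s + b_i` with multiplicities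
`m_i`, standing for the meromorphic function `s ↦ Π_i Γ(ℓ_i(s))^{m_i}` (Beta products are the
case `Γ(x)Γ(y)Γ(x+y)⁻¹`). -/
structure GammaFamily (ι : Type) where
  a : ι → ℚ
  b : ι → ℚ
  m : ι → ℤ

namespace GammaFamily

variable {ι : Type} [Fintype ι]

/-- The argument `ℓ_i(s)`. -/
def arg (D : GammaFamily ι) (i : ι) (s : ℚ) : ℚ := D.a i * s + D.b i

open Classical in
/-- **Pole weight** of the family at `t`: `Σ_i m_i · [ℓ_i(t) ∈ −ℕ]` — the order of pole of
`Π Γ(ℓ_i)^{m_i}` at `s = t` (Γ has simple poles exactly at `0, −1, −2, …` and no zeros). -/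
def poleWeight (D : GammaFamily ι) (t : ℚ) : ℤ :=
  ∑ i, if (∃ k : ℕ, D.arg i t = -(k : ℚ)) then D.m i else 0

/-- **Divisor balance**: the pole divisor of the family is finite (as it must be if the family is
an exponential-monomial times a rational function of `s`). Decidable on any given data by
bookkeeping of one-sided arithmetic progressions. -/
def DivisorBalanced (D : GammaFamily ι) : Prop := {t : ℚ | D.poleWeight t ≠ 0}.Finite

/-- The Koblitz–Ogus/Deligne Hodge sum of the specialised family at `s`, twisted by `u`. -/
def hodgeSum (D : GammaFamily ι) (s : ℚ) (u : ℕ) : ℚ :=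
  ∑ i, (D.m i : ℚ) * Int.fract ((u : ℚ) * D.arg i s)

/-- `s` is not a pole of any factor. -/
def NonPoleAt (D : GammaFamily ι) (s : ℚ) : Prop := ∀ i (k : ℕ), D.arg i s ≠ -(k : ℚ)

/-- Admissible twists at `s`: `u > 0` coprime to all denominators of the `ℓ_i(s)`. -/
def TwistAt (D : GammaFamily ι) (s : ℚ) (u : ℕ) : Prop := 0 < u ∧ ∀ i, Nat.Coprime u (D.arg i s).den

/-- **Hodge balance at `s`**: the Hodge sum is independent of the admissible twist — Deligne's
Hodge-type condition for the specialised Γ-monomial (`IsHodgeTypeGammaMonomial` up to the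
normalisation of integer classes). -/
def HodgeBalancedAt (D : GammaFamily ι) (s : ℚ) : Prop :=
  ∀ u v : ℕ, D.TwistAt s u → D.TwistAt s v → D.hodgeSum s u = D.hodgeSum s v

/-- The real function of the family (Mathlib's `Real.Gamma`, `zpow`). -/
def fn (D : GammaFamily ι) (s : ℝ) : ℝ := ∏ i, Real.Gamma ((D.a i : ℝ) * s + (D.b i : ℝ)) ^ (D.m i)

end GammaFamily

/-- **FIRST LEMMA of card `divisor-classifies-families` (combinatorial core).** A divisor-balanced
Γ-family is Hodge-balanced at every non-polar rational argument. Proof route (paper): balance ⇒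
(after Gauss multiplication on each slope and reflection on negative slopes) the translate classes
mod ℤ have zero total multiplicity ⇒ the family is a ℤ-combination of multiplication, reflection
and translation families ⇒ specialise and apply the EASY direction of Koblitz–Ogus (distribution
and reflection vectors are killed by every Bernoulli twist `β(u·)`, tree: `KoblitzOgus.bern_unit_dist`). -/
def DivisorLemma : Prop :=
  ∀ (ι : Type) [Fintype ι] (D : GammaFamily ι), D.DivisorBalanced →
    ∀ s : ℚ, D.NonPoleAt s → D.HodgeBalancedAt s

/-- **Analytic bridge**: a Γ-family that is an exponential-monomial times a rational function on
some interval is divisor-balanced (analytic continuation; Γ is meromorphic with poles exactly at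
`−ℕ` and zero-free). -/
def FunctionalImpliesBalanced : Prop :=
  ∀ (ι : Type) [Fintype ι] (D : GammaFamily ι) (lo hi : ℝ), lo < hi →
    (∃ (C q : ℝ) (P Q : Polynomial ℝ), C ≠ 0 ∧ 0 < q ∧ Q ≠ 0 ∧
      ∀ s ∈ Set.Ioo lo hi, Q.eval s * D.fn s = C * q ^ s * P.eval s) →
    D.DivisorBalanced

/-- Affine evaluation of exponent data: `x_j(s) = A_j s + B_j`. -/
def affEval {N : ℕ} (A B : Fin N → ℚ) (s : ℚ) : Fin N → ℚ := fun j => A j * s + B j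

/-- The Γ-family of a pair of Beta-product families
`Π_j B(x_j(s), y_j(s))` versus `Π_l B(x'_l(s), y'_l(s))` (`B(x,y) = Γ(x)Γ(y)/Γ(x+y)`). -/
def betaFamily {N N' : ℕ} (A B C D : Fin N → ℚ) (A' B' C' D' : Fin N' → ℚ) :
    GammaFamily ((Fin N ⊕ (Fin N ⊕ Fin N)) ⊕ (Fin N' ⊕ (Fin N' ⊕ Fin N'))) where
  a := Sum.elim (Sum.elim A (Sum.elim C (A + C))) (Sum.elim A' (Sum.elim C' (A' + C')))
  b := Sum.elim (Sum.elim B (Sum.elim D (B + D))) (Sum.elim B' (Sum.elim D' (B' + D')))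
  m := Sum.elim (Sum.elim 1 (Sum.elim 1 (-1))) (Sum.elim (-1) (Sum.elim (-1) 1))

/-- **THE SECTOR the card closes**: `CompleteModGammaSector` restricted to exponent-uniform
(divisor-balanced) Beta-product families — at every admissible rational `s` the specialised pair
is a typed Γ-pair, hence lies in the sector, with NO numerical transcendence input. Hypotheses:
divisor balance of the family, admissibility at `s`, the Hodge difference at the untwisted `u = 1`
equal to the number `k` of disc factors (a finite check), `c` algebraic, equal values. -/
def BetaFamiliesModGamma : Prop :=
  ∀ (N N' k : ℕ) (A B C D : Fin N → ℚ) (A' B' C' D' : Fin N' → ℚ),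
    (betaFamily A B C D A' B' C' D').DivisorBalanced →
    ∀ s : ℚ,
      (∀ j, 0 < affEval A B s j ∧ 0 < affEval C D s j ∧
        Int.fract (affEval A B s j) ≠ 0 ∧ Int.fract (affEval C D s j) ≠ 0) →
      (∀ l, 0 < affEval A' B' s l ∧ 0 < affEval C' D' s l ∧
        Int.fract (affEval A' B' s l) ≠ 0 ∧ Int.fract (affEval C' D' s l) ≠ 0) →
      (betaFamily A B C D A' B' C' D').hodgeSum s 1 = (k : ℚ) →
      ∀ (c : ℝ), IsAlgebraic ℚ c →
      ∀ (ρ : IntegralRep N) (ρ' : IntegralRep (2 * k + N')),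
        ρ.domain = {t | ∀ j, t j ∈ Set.Ioo (0:ℝ) 1} →
        Set.EqOn ρ.integrand (fun t => ∏ j, (t j) ^ ((affEval A B s j : ℝ) - 1) *
          (1 - t j) ^ ((affEval C D s j : ℝ) - 1)) ρ.domain →
        ρ'.domain = {z | (∑ i : Fin (2 * k), (z (Fin.castAdd N' i)) ^ 2) < 1 ∧
          ∀ l : Fin N', z (Fin.natAdd (2 * k) l) ∈ Set.Ioo (0:ℝ) 1} →
        Set.EqOn ρ'.integrand (fun z => c * (k.factorial : ℝ) *
          ∏ l, (z (Fin.natAdd (2 * k) l)) ^ ((affEval A' B' s l : ℝ) - 1) *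
            (1 - z (Fin.natAdd (2 * k) l)) ^ ((affEval C' D' s l : ℝ) - 1)) ρ'.domain →
        ρ.value = ρ'.value →
        of ρ - of ρ' ∈ relations ⊔ AddSubgroup.closure gammaPairSet

/-- Bookkeeping target for the crux-plan: the family Hodge sum of `betaFamily` at `s` is exactly
the crux's Hodge difference of the specialised exponents (so `DivisorLemma` discharges the
Hodge hypothesis of the Γ-pair uniformly in `u`). -/
def BetaFamilyHodgeSumSpec : Prop :=
  ∀ (N N' : ℕ) (A B C D : Fin N → ℚ) (A' B' C' D' : Fin N' → ℚ) (s : ℚ) (u : ℕ),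
    (betaFamily A B C D A' B' C' D').hodgeSum s u =
      (∑ j, (Int.fract ((u : ℚ) * affEval A B s j) + Int.fract ((u : ℚ) * affEval C D s j) -
          Int.fract ((u : ℚ) * (affEval A B s j + affEval C D s j)))) -
        ∑ l, (Int.fract ((u : ℚ) * affEval A' B' s l) + Int.fract ((u : ℚ) * affEval C' D' s l) -
          Int.fract ((u : ℚ) * (affEval A' B' s l + affEval C' D' s l)))

/-- Sanity instance (Legendre duplication `Γ(s)Γ(s+½)Γ(2s)⁻¹ = 2^{1−2s}√π`): the family. -/
def dupFamily : GammaFamily (Fin 3) where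
  a := ![1, 1, 2]
  b := ![0, 1/2, 0]
  m := ![1, 1, -1]

/-- … its Hodge sums at `s = 1/4` agree for the twists `u = 1` and `u = 3` (both `= 1/2`). -/
example : dupFamily.hodgeSum (1/4) 1 = dupFamily.hodgeSum (1/4) 3 := by
  native_decide

/-! ## §C  Card `complement-lattice-merge`: the Galois connection `S ↦ CompleteMod S` -/

/-- **Antitonicity along derivability**: completeness modulo `T` transfers to any `S` from which
`T` is derivable. -/
theorem completeMod_anti {S T : Set FormalRep} (hT : CompleteMod T)
    (h : T ⊆ ↑(relations ⊔ AddSubgroup.closure S)) : CompleteMod S := by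
  intro n m r r' hr hr' hv
  have hle : relations ⊔ AddSubgroup.closure T ≤ relations ⊔ AddSubgroup.closure S :=
    sup_le le_sup_left ((AddSubgroup.closure_le _).mpr h)
  exact hle (hT r r' hr hr' hv)

/-- Monotonicity in the axiom set. -/
theorem completeMod_mono {S T : Set FormalRep} (hS : CompleteMod S) (h : S ⊆ T) : CompleteMod T :=
  completeMod_anti hS (fun d hd => AddSubgroup.mem_sup_right (AddSubgroup.subset_closure (h hd)))

/-- Top of the lattice: complete modulo everything of value zero (trivially). -/
theorem completeMod_ker : CompleteMod (eval.ker : Set FormalRep) := by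
  intro n m r r' _ _ hv
  refine AddSubgroup.mem_sup_right (AddSubgroup.subset_closure ?_)
  show of r - of r' ∈ eval.ker
  rw [AddMonoidHom.mem_ker, eval_of_sub_of, hv, sub_self]

/-- Bottom of the lattice: the summit is `CompleteMod ∅`. -/
theorem summit_iff_completeMod_empty : _root_.KontsevichZagierPeriods ↔ CompleteMod ∅ := by
  rw [_root_.KontsevichZagierPeriods_iff]
  constructor
  · intro h n m r r' hr hr' hv
    exact AddSubgroup.mem_sup_left (h r r' hr hr' hv)
  · intro h n m r r' hr hr' hv
    have := h r r' hr hr' hv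
    rwa [AddSubgroup.closure_empty, sup_bot_eq] at this

/-- **THE MERGE**: the crux follows from the common residual `CompleteMod (gammaPairSet ∪ S)` of
all complement cruxes together with accessibility of the extra sectors `S` modulo Γ. -/
theorem crux_of_merge {S : Set FormalRep} (hbig : CompleteMod (gammaPairSet ∪ S))
    (hacc : S ⊆ ↑(relations ⊔ AddSubgroup.closure gammaPairSet)) : CompleteModGammaSector :=
  crux_iff_completeMod.mpr (completeMod_anti hbig (Set.union_subset
    (fun d hd => AddSubgroup.mem_sup_right (AddSubgroup.subset_closure hd)) hacc))

/-- Conversely the crux implies every larger residual. -/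
theorem merge_of_crux (h : CompleteModGammaSector) (S : Set FormalRep) :
    CompleteMod (gammaPairSet ∪ S) :=
  completeMod_mono (crux_iff_completeMod.mp h) Set.subset_union_left

end Summit.KontsevichZagierPeriods.KontsevichZagierPeriods.Cruxes.CompleteModGammaSector.IdeatorTwo
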